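import Summits.KontsevichZagierPeriods.KontsevichZagierPeriods.Theorems.IsogenyCertificatesGenusTwoRealPeriodCellStubSubband
import Literature.NumberTheory.Transcendental.KZLogCalculus

/-!
# `BetaLinearSector` (stmt-KontsevichZagierPeriods-3897), line `fermat-sector-transport`:
# auxiliaries for GREEN STUB 3 `stub_bandNewtonLeibniz_of_cad_of_subband` (the engine)

General lemmas for the assembly of the engine of Green's formula in the Kontsevich–Zagier calculus
(Newton–Leibniz down a closed band `{a₀ ≤ x ≤ a₁, α x ≤ y ≤ β x}` off a null set, from an adapted
cylindrical decomposition and one sub-band move per band):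

* strict epigraphs / hypographs of semialgebraic functions, the open band;
* `engine_fibre_telescope` — the one-dimensional combinatorial lemma: if the bands `j ∈ B` of a
  strictly increasing finite sequence of sections lie in `(a, b)` and cover `(a, b)` up to section
  values, then `∑_{j ∈ B} (G (ξ_j) − G (ξ_{j-1})) = G b − G a` for every `G`;
* `engine_inner` — a band with fibre inside a bounded interval is an inner band;
* `engine_bandOver_not_subset_null` — an inner band over a base set of positive measure is not
  contained in a null set (Cavalieri);
* `bandNewtonLeibnizEngine_aux_cutPartition` — cutting a representation along a finite partition of
  its own space (iterated rule (1); the registered auxiliary anchor of this file).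

References: M. Kontsevich, D. Zagier, *Periods* (2001), §1.2; S. Basu, R. Pollack, M.-F. Roy,
*Algorithms in Real Algebraic Geometry* (2006), Def. 5.1. No definition, no named fact.
-/

noncomputable section

open scoped BigOperators ENNReal
open MeasureTheory Set MvPolynomial
open Literature.NumberTheory.Transcendental
open Literature.ModelTheory.ExponentialFields

namespace Summit.KontsevichZagierPeriods.FermatIsogeny.BetaLinearSector

/-! ## Strict epigraphs and hypographs, the open band -/

/-- The strict hypograph `{(x, u) | x ∈ s, u < f x}` of a real `ℚ`-semialgebraic function is
`ℚ`-semialgebraic (graph elimination, Tarski–Seidenberg). [cite: BochnakCosteRoy1998, §2.2] -/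
theorem engine_isSemialgebraic_setOf_lt {m : ℕ} {s : Set (Fin m → ℝ)} {f : (Fin m → ℝ) → ℝ}
    (hf : IsSemialgebraicFunOn ℚ s f) :
    IsSemialgebraic ℚ {v : Fin (m + 1) → ℝ | Fin.init v ∈ s ∧ v (Fin.last m) < f (Fin.init v)} := by
  -- adapted from `IsSemialgebraicFunOn.isSemialgebraic_setOf_lt` (KZTorusLogRep.lean)
  have hT : IsSemialgebraic ℚ
      {u : Fin (m + 2) → ℝ | u (Fin.castSucc (Fin.last m)) < u (Fin.last (m + 1))} := by
    simpa using isSemialgebraic_setOf_eval_lt (k := ℚ) (R := ℝ)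
      (X (Fin.castSucc (Fin.last m))) (X (Fin.last (m + 1)))
  convert hf.isSemialgebraic_setOf_snoc_mem tarski_seidenberg_real_holds hT using 1
  ext v
  simp

/-- The strict epigraph `{(x, u) | x ∈ s, f x < u}` of a real `ℚ`-semialgebraic function is
`ℚ`-semialgebraic (graph elimination, Tarski–Seidenberg). [cite: BochnakCosteRoy1998, §2.2] -/
theorem engine_isSemialgebraic_setOf_gt {m : ℕ} {s : Set (Fin m → ℝ)} {f : (Fin m → ℝ) → ℝ}
    (hf : IsSemialgebraicFunOn ℚ s f) :
    IsSemialgebraic ℚ {v : Fin (m + 1) → ℝ | Fin.init v ∈ s ∧ f (Fin.init v) < v (Fin.last m)} := by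
  -- adapted from `IsSemialgebraicFunOn.isSemialgebraic_setOf_gt` (KZTorusLogRep.lean)
  have hT : IsSemialgebraic ℚ
      {u : Fin (m + 2) → ℝ | u (Fin.last (m + 1)) < u (Fin.castSucc (Fin.last m))} := by
    simpa using isSemialgebraic_setOf_eval_lt (k := ℚ) (R := ℝ)
      (X (Fin.last (m + 1))) (X (Fin.castSucc (Fin.last m)))
  convert hf.isSemialgebraic_setOf_snoc_mem tarski_seidenberg_real_holds hT using 1
  ext v
  simp

/-- The open band `{a₀ < x < a₁, α x < y < β x} ⊆ ℝ²` over the strip is `ℚ`-semialgebraic when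
`α`, `β` are `ℚ`-semialgebraic on the strip. [cite: BochnakCosteRoy1998, §2.2] -/
theorem engine_isSemialgebraic_openBand {a₀ a₁ : ℝ} {α β : ℝ → ℝ}
    (hα : IsSemialgebraicFunOn ℚ {z : Fin 1 → ℝ | z 0 ∈ Ioo a₀ a₁} fun z => α (z 0))
    (hβ : IsSemialgebraicFunOn ℚ {z : Fin 1 → ℝ | z 0 ∈ Ioo a₀ a₁} fun z => β (z 0)) :
    IsSemialgebraic ℚ {p : Fin 2 → ℝ | p 0 ∈ Ioo a₀ a₁ ∧ α (p 0) < p 1 ∧ p 1 < β (p 0)} := by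
  convert (engine_isSemialgebraic_setOf_gt hα).inter (engine_isSemialgebraic_setOf_lt hβ) using 1
  ext p
  simp only [mem_setOf_eq, mem_inter_iff]
  exact ⟨fun ⟨h0, h1, h2⟩ => ⟨⟨h0, h1⟩, h0, h2⟩, fun ⟨⟨h0, h1⟩, _, h2⟩ => ⟨h0, h1, h2⟩⟩

/-! ## The one-dimensional telescoping lemma -/

/-- Telescoping over `Finset.Ioc m n ⊆ ℕ`: `∑_{m < k ≤ n} (f k − f (k-1)) = f n − f m`. [folklore] -/
theorem engine_sum_Ioc_telescope (f : ℕ → ℝ) {m n : ℕ} (hmn : m ≤ n) :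
    ∑ k ∈ Finset.Ioc m n, (f k - f (k - 1)) = f n - f m := by
  induction n, hmn using Nat.le_induction with
  | base => simp
  | succ n hmn ih => rw [Finset.sum_Ioc_succ_top hmn, ih, Nat.add_sub_cancel]; ring

section Fibre

variable {m l : ℕ} (ξ : Fin l → (Fin m → ℝ) → ℝ) (x : Fin m → ℝ)

/-- If the bands `j ∈ B` lie in `(a, b)` (`a < b`) and `(a, b)` is covered by section values and
`B`-bands, then `a` is a section value. [cite: BasuPollackRoy2006, Def. 5.1] -/
theorem engine_exists_eq_left (hmono : StrictMono fun i => ξ i x) (B : Finset (Fin (l + 1)))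
    {a b : ℝ} (hab : a < b)
    (hB : ∀ j ∈ B, ∀ t : ℝ, bandLower ξ j x < t → (t : EReal) < bandUpper ξ j x → a < t ∧ t < b)
    (hcov : ∀ t : ℝ, a < t → t < b →
      (∃ i, t = ξ i x) ∨ ∃ j ∈ B, bandLower ξ j x < t ∧ (t : EReal) < bandUpper ξ j x) :
    ∃ i : Fin l, a = ξ i x := by
  by_contra hne
  rcases CylindricalDecomposition.exists_eq_or_exists_mem_band ξ x hmono a with ⟨i, hi⟩ | ⟨ja, hja1, hja2⟩
  · exact hne ⟨i, hi⟩
  · obtain ⟨t, ht1, ht2⟩ :=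
      EReal.exists_between_coe_real (lt_min (EReal.coe_lt_coe_iff.2 hab) hja2)
    rw [lt_min_iff] at ht2
    have hat : a < t := EReal.coe_lt_coe_iff.1 ht1
    have htb : t < b := EReal.coe_lt_coe_iff.1 ht2.1
    have htband : bandLower ξ ja x < t ∧ (t : EReal) < bandUpper ξ ja x := ⟨hja1.trans ht1, ht2.2⟩
    rcases hcov t hat htb with ⟨i, hi⟩ | ⟨j, hjB, hj⟩
    · exact CylindricalDecomposition.not_mem_band_of_eq ξ x hmono hi htband
    · have hjj : j = ja := CylindricalDecomposition.band_eq_band ξ x hmono hj htband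
      subst hjj
      exact lt_irrefl a (hB j hjB a hja1 hja2).1

/-- If the bands `j ∈ B` lie in `(a, b)` (`a < b`) and `(a, b)` is covered by section values and
`B`-bands, then `b` is a section value. [cite: BasuPollackRoy2006, Def. 5.1] -/
theorem engine_exists_eq_right (hmono : StrictMono fun i => ξ i x) (B : Finset (Fin (l + 1)))
    {a b : ℝ} (hab : a < b)
    (hB : ∀ j ∈ B, ∀ t : ℝ, bandLower ξ j x < t → (t : EReal) < bandUpper ξ j x → a < t ∧ t < b)
    (hcov : ∀ t : ℝ, a < t → t < b →
      (∃ i, t = ξ i x) ∨ ∃ j ∈ B, bandLower ξ j x < t ∧ (t : EReal) < bandUpper ξ j x) :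
    ∃ i : Fin l, b = ξ i x := by
  by_contra hne
  rcases CylindricalDecomposition.exists_eq_or_exists_mem_band ξ x hmono b with ⟨i, hi⟩ | ⟨jb, hjb1, hjb2⟩
  · exact hne ⟨i, hi⟩
  · obtain ⟨t, ht1, ht2⟩ :=
      EReal.exists_between_coe_real (max_lt (EReal.coe_lt_coe_iff.2 hab) hjb1)
    rw [max_lt_iff] at ht1
    have hat : a < t := EReal.coe_lt_coe_iff.1 ht1.1
    have htb : t < b := EReal.coe_lt_coe_iff.1 ht2
    have htband : bandLower ξ jb x < t ∧ (t : EReal) < bandUpper ξ jb x := ⟨ht1.2, ht2.trans hjb2⟩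
    rcases hcov t hat htb with ⟨i, hi⟩ | ⟨j, hjB, hj⟩
    · exact CylindricalDecomposition.not_mem_band_of_eq ξ x hmono hi htband
    · have hjj : j = jb := CylindricalDecomposition.band_eq_band ξ x hmono hj htband
      subst hjj
      exact lt_irrefl b (hB j hjB b hjb1 hjb2).2

/-- With `a = ξ_{i_a} x < b = ξ_{i_b} x`: the bands `j ∈ B` are exactly the bands strictly between
the two sections, `i_a < j ≤ i_b`. [cite: BasuPollackRoy2006, Def. 5.1] -/
theorem engine_mem_iff (hmono : StrictMono fun i => ξ i x) (B : Finset (Fin (l + 1)))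
    {a b : ℝ} {ia ib : Fin l} (hia : a = ξ ia x) (hib : b = ξ ib x)
    (hB : ∀ j ∈ B, ∀ t : ℝ, bandLower ξ j x < t → (t : EReal) < bandUpper ξ j x → a < t ∧ t < b)
    (hcov : ∀ t : ℝ, a < t → t < b →
      (∃ i, t = ξ i x) ∨ ∃ j ∈ B, bandLower ξ j x < t ∧ (t : EReal) < bandUpper ξ j x)
    (j : Fin (l + 1)) : j ∈ B ↔ (ia : ℕ) < j ∧ (j : ℕ) ≤ ib := by
  constructor
  · intro hj
    obtain ⟨t, ht1, ht2⟩ := CylindricalDecomposition.exists_mem_band ξ x hmono j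
    obtain ⟨hat, htb⟩ := hB j hj t ht1 ht2
    obtain ⟨-, hiff⟩ := (CylindricalDecomposition.mem_band_iff ξ x hmono j t).1 ⟨ht1, ht2⟩
    refine ⟨(hiff ia).1 (hia ▸ hat), ?_⟩
    by_contra h
    have hlt : ξ ib x < t := (hiff ib).2 (not_le.1 h)
    rw [← hib] at hlt
    exact lt_asymm hlt htb
  · rintro ⟨h1, h2⟩
    obtain ⟨t, ht1, ht2⟩ := CylindricalDecomposition.exists_mem_band ξ x hmono j
    obtain ⟨hne, hiff⟩ := (CylindricalDecomposition.mem_band_iff ξ x hmono j t).1 ⟨ht1, ht2⟩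
    have hat : a < t := by rw [hia]; exact (hiff ia).2 h1
    have htb : t < b := by
      rw [hib]
      refine lt_of_le_of_ne (not_lt.1 fun h => ?_) (hne ib).symm
      exact absurd ((hiff ib).1 h) (not_lt.2 h2)
    rcases hcov t hat htb with ⟨i, hi⟩ | ⟨j', hj'B, hj'⟩
    · exact absurd hi.symm (hne i)
    · rw [CylindricalDecomposition.band_eq_band ξ x hmono ⟨ht1, ht2⟩ hj']
      exact hj'B

/-- **Telescoping along a fibre.** Let `ξ₀ x < ⋯ < ξ_{l-1} x` be section values, `B` a set of bands,
`a ≤ b`. If every band `j ∈ B` lies in `(a, b)` and every point of `(a, b)` is a section value or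
lies in a band `j ∈ B`, then `∑_{j ∈ B} (G (ξ_j x) − G (ξ_{j-1} x)) = G b − G a` for every `G`
(`B` is the contiguous block of bands between the sections `a` and `b`). [folklore] -/
theorem engine_fibre_telescope (hmono : StrictMono fun i => ξ i x) (B : Finset (Fin (l + 1)))
    {a b : ℝ} (hab : a ≤ b)
    (hB : ∀ j ∈ B, ∀ t : ℝ, bandLower ξ j x < t → (t : EReal) < bandUpper ξ j x → a < t ∧ t < b)
    (hcov : ∀ t : ℝ, a < t → t < b →
      (∃ i, t = ξ i x) ∨ ∃ j ∈ B, bandLower ξ j x < t ∧ (t : EReal) < bandUpper ξ j x)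
    (G : ℝ → ℝ) :
    ∑ j ∈ B, (G (bandUpper ξ j x).toReal - G (bandLower ξ j x).toReal) = G b - G a := by
  rcases hab.lt_or_eq with hab | rfl
  swap
  · rw [sub_self]
    refine Finset.sum_eq_zero fun j hj => ?_
    obtain ⟨t, ht1, ht2⟩ := CylindricalDecomposition.exists_mem_band ξ x hmono j
    obtain ⟨h1, h2⟩ := hB j hj t ht1 ht2
    exact absurd (h1.trans h2) (lt_irrefl _)
  obtain ⟨ia, hia⟩ := engine_exists_eq_left ξ x hmono B hab hB hcov
  obtain ⟨ib, hib⟩ := engine_exists_eq_right ξ x hmono B hab hB hcov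
  have hmem := engine_mem_iff ξ x hmono B hia hib hB hcov
  have hiaib : ia < ib := hmono.lt_iff_lt.1 (by rw [← hia, ← hib]; exact hab)
  set f : ℕ → ℝ := fun k => if h : k < l then G (ξ ⟨k, h⟩ x) else 0 with hf
  have hfa : f ia = G a := by rw [hia]; exact dif_pos ia.isLt
  have hfb : f ib = G b := by rw [hib]; exact dif_pos ib.isLt
  calc ∑ j ∈ B, (G (bandUpper ξ j x).toReal - G (bandLower ξ j x).toReal)
      = ∑ k ∈ Finset.Ioc (ia : ℕ) ib, (f k - f (k - 1)) := by
        refine Finset.sum_bij' (fun j _ => (j : ℕ))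
          (fun k hk => ⟨k, lt_of_le_of_lt (Finset.mem_Ioc.1 hk).2 (Nat.lt_succ_of_lt ib.isLt)⟩)
          (fun j hj => Finset.mem_Ioc.2 ((hmem j).1 hj)) (fun k hk => (hmem _).2 (Finset.mem_Ioc.1 hk))
          (fun j _ => rfl) (fun k _ => rfl) fun j hj => ?_
        obtain ⟨h1, h2⟩ := (hmem j).1 hj
        have hjl : (j : ℕ) < l := lt_of_le_of_lt h2 ib.isLt
        have h0 : j ≠ 0 := fun h => by rw [h, Fin.val_zero] at h1; exact Nat.not_lt_zero _ h1
        have hl : j ≠ Fin.last l := fun h => by rw [h, Fin.val_last] at hjl; exact lt_irrefl _ hjl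
        have hj1 : (j : ℕ) - 1 < l := lt_of_le_of_lt (Nat.sub_le _ _) hjl
        rw [bandUpper_of_ne_last ξ j hl, bandLower_of_ne_zero ξ j h0, EReal.toReal_coe,
          EReal.toReal_coe]
        simp only [hf, dif_pos hjl, dif_pos hj1]
        rfl
    _ = f ib - f ia := engine_sum_Ioc_telescope f (Fin.val_fin_le.2 hiaib.le)
    _ = G b - G a := by rw [hfa, hfb]

/-- A band whose fibre over `x` lies in a bounded interval `(a, b)` is an inner band
(`0 < j < ℓ`). [folklore] -/
theorem engine_inner {j : Fin (l + 1)} {a b : ℝ}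
    (hB : ∀ t : ℝ, bandLower ξ j x < t → (t : EReal) < bandUpper ξ j x → a < t ∧ t < b) :
    j ≠ 0 ∧ j ≠ Fin.last l := by
  constructor
  · rintro rfl
    obtain ⟨c, hc⟩ := KZ.exists_coe_lt_bandUpper ξ 0 x
    have h := hB (min c a - 1) (by rw [bandLower_zero]; exact EReal.bot_lt_coe _)
      (lt_of_lt_of_le (EReal.coe_lt_coe_iff.2 (by linarith [min_le_left c a])) hc.le)
    linarith [h.1, min_le_right c a]
  · rintro rfl
    obtain ⟨c, hc⟩ := KZ.exists_bandLower_lt_coe ξ (Fin.last l) x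
    have h := hB (max c b + 1)
      (lt_of_le_of_lt hc.le (EReal.coe_lt_coe_iff.2 (by linarith [le_max_left c b])))
      (by rw [bandUpper_last]; exact EReal.coe_lt_top _)
    linarith [h.2, le_max_right c b]

end Fibre

/-! ## Bands over cells: closed band versus open band, positivity of measure -/

/-- The closed band `[ξ_{j-1}, ξ_j]` over `C` is the open band together with the two boundary
graphs. [folklore] -/
theorem engine_band_subset {m l : ℕ} {C : Set (Fin m → ℝ)} (ξ : Fin l → (Fin m → ℝ) → ℝ)
    {j : Fin (l + 1)} (h0 : j ≠ 0) (hl : j ≠ Fin.last l) {z : Fin (m + 1) → ℝ}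
    (hz : z ∈ KZlog.band C (fun x => (bandLower ξ j x).toReal) fun x => (bandUpper ξ j x).toReal) :
    z ∈ bandOver C ξ j ∨
      z ∈ {z : Fin (m + 1) → ℝ | Fin.init z ∈ C ∧ z (Fin.last m) = (bandLower ξ j (Fin.init z)).toReal} ∪
        {z | Fin.init z ∈ C ∧ z (Fin.last m) = (bandUpper ξ j (Fin.init z)).toReal} := by
  -- adapted from `KZ.exists_band_sub_base_mem_newtonLeibnizRel` (KZGroundingRelations.lean)
  simp only [KZlog.mem_band] at hz
  obtain ⟨hzC, h1, h2⟩ := hz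
  rcases h1.lt_or_eq with h1 | h1
  · rcases h2.lt_or_eq with h2 | h2
    · refine Or.inl (mem_bandOver_iff.2 ⟨hzC, ?_, ?_⟩)
      · rw [bandLower_of_ne_zero ξ j h0, EReal.coe_lt_coe_iff]
        rwa [bandLower_of_ne_zero ξ j h0, EReal.toReal_coe] at h1
      · rw [bandUpper_of_ne_last ξ j hl, EReal.coe_lt_coe_iff]
        rwa [bandUpper_of_ne_last ξ j hl, EReal.toReal_coe] at h2
    · exact Or.inr (Or.inr ⟨hzC, h2⟩)
  · exact Or.inr (Or.inl ⟨hzC, h1.symm⟩)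

/-- The lower boundary of an inner band is `ℚ`-semialgebraic on the cell. [folklore] -/
theorem engine_isSemialgebraicFunOn_lower {m l : ℕ} {C : Set (Fin m → ℝ)}
    (ξ : Fin l → (Fin m → ℝ) → ℝ) (hξ : ∀ i, IsSemialgebraicFunOn ℚ C (ξ i)) {j : Fin (l + 1)}
    (h0 : j ≠ 0) : IsSemialgebraicFunOn ℚ C fun x => (bandLower ξ j x).toReal :=
  (hξ (j.pred h0)).congr fun x _ => by rw [bandLower_of_ne_zero ξ j h0, EReal.toReal_coe]

/-- The upper boundary of an inner band is `ℚ`-semialgebraic on the cell. [folklore] -/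
theorem engine_isSemialgebraicFunOn_upper {m l : ℕ} {C : Set (Fin m → ℝ)}
    (ξ : Fin l → (Fin m → ℝ) → ℝ) (hξ : ∀ i, IsSemialgebraicFunOn ℚ C (ξ i)) {j : Fin (l + 1)}
    (hl : j ≠ Fin.last l) : IsSemialgebraicFunOn ℚ C fun x => (bandUpper ξ j x).toReal :=
  (hξ (j.castPred hl)).congr fun x _ => by rw [bandUpper_of_ne_last ξ j hl, EReal.toReal_coe]

/-- **An inner band over a base set of positive measure is not inside a null set**: the closed
band has volume `∫_C (ξ_j − ξ_{j-1}) > 0` (Cavalieri) and differs from the open band by two null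
graphs. [folklore] -/
theorem engine_bandOver_not_subset_null {m l : ℕ} {C : Set (Fin m → ℝ)} (hC : IsSemialgebraic ℚ C)
    (hC0 : volume C ≠ 0) (ξ : Fin l → (Fin m → ℝ) → ℝ) (hξ : ∀ i, IsSemialgebraicFunOn ℚ C (ξ i))
    (hmono : ∀ x ∈ C, StrictMono fun i => ξ i x) {j : Fin (l + 1)} (h0 : j ≠ 0)
    (hl : j ≠ Fin.last l) {Z : Set (Fin (m + 1) → ℝ)} (hZ0 : volume Z = 0)
    (hsub : bandOver C ξ j ⊆ Z) : False := by
  set lo : (Fin m → ℝ) → ℝ := fun x => (bandLower ξ j x).toReal with hlo_def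
  set hi : (Fin m → ℝ) → ℝ := fun x => (bandUpper ξ j x).toReal with hhi_def
  have hlosa : IsSemialgebraicFunOn ℚ C lo := engine_isSemialgebraicFunOn_lower ξ hξ h0
  have hhisa : IsSemialgebraicFunOn ℚ C hi := engine_isSemialgebraicFunOn_upper ξ hξ hl
  have hlt : ∀ x ∈ C, lo x < hi x := fun x hx =>
    KZ.toReal_bandLower_lt_toReal_bandUpper ξ (hmono x hx) h0 hl
  have hCm : MeasurableSet C := IsSemialgebraic.measurableSet_holds hC
  have hBm : MeasurableSet (KZlog.band C lo hi) :=
    IsSemialgebraic.measurableSet_holds (KZlog.isSemialgebraic_band hlosa hhisa)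
  -- the closed band is null
  have hnull : volume (KZlog.band C lo hi) = 0 := by
    refine measure_mono_null (fun z hz => ?_) (measure_union_null (measure_mono_null hsub hZ0)
      (measure_union_null (KZ.volume_graph_eq_zero hlosa) (KZ.volume_graph_eq_zero hhisa)))
    exact engine_band_subset ξ h0 hl hz
  -- the closed band has volume `∫_C (hi - lo)` (adapted from `KZ.exists_band_sub_base_mem_newtonLeibnizRel`)
  have hlin : ∫⁻ x in C, ENNReal.ofReal (hi x - lo x) = volume (KZlog.band C lo hi) := by
    rw [Grounding.volume_eq_lintegral_fibre hBm, ← lintegral_indicator hCm]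
    refine lintegral_congr fun x => ?_
    by_cases hx : x ∈ C
    · rw [indicator_of_mem hx]
      have : FibreLength.fibre (KZlog.band C lo hi) x = Icc (lo x) (hi x) := by
        ext t
        simp [FibreLength.fibre, KZlog.snoc_mem_band, hx]
      rw [this, Real.volume_Icc]
    · rw [indicator_of_notMem hx]
      have : FibreLength.fibre (KZlog.band C lo hi) x = ∅ := by
        ext t
        simp [FibreLength.fibre, KZlog.snoc_mem_band, hx]
      rw [this, measure_empty]
  rw [hnull] at hlin
  have hmeas : AEMeasurable (fun x => ENNReal.ofReal (hi x - lo x)) (volume.restrict C) :=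
    (KZ.aestronglyMeasurable_of_isSemialgebraicFunOn (IsSemialgebraicFunOn.sub_holds hhisa hlosa)
      hCm).aemeasurable.ennreal_ofReal
  rw [lintegral_eq_zero_iff' hmeas] at hlin
  have hae : ∀ᵐ x ∂(volume.restrict C), x ∉ C := by
    filter_upwards [hlin] with x hx hxC
    have h := hlt x hxC
    simp only [Pi.zero_apply, ENNReal.ofReal_eq_zero] at hx
    linarith
  rw [ae_restrict_iff' hCm] at hae
  exact hC0 (measure_eq_zero_iff_ae_notMem.2 (hae.mono fun x hx hxC => hx hxC hxC))

/-! ## Cutting a representation along a partition of its own space -/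

/-- **Cutting along a finite partition** (iterated rule (1), same dimension): if `𝒮` is a finite
partition of `ℝⁿ` and `R_C = r|_{r.domain ∩ C}` for `C ∈ 𝒮`, then `[r] − ∑_C [R_C] ∈ relations`.
Registered auxiliary anchor of the engine stub (aux file of `stub_bandNewtonLeibniz_of_cad_of_subband`).
[cite: KontsevichZagier2001, §1.2 rule (1)] -/
theorem bandNewtonLeibnizEngine_aux_cutPartition :
    ∀ {n : ℕ} (r : KZ.IntegralRep n) (𝒮 : Finset (Set (Fin n → ℝ))),
      Setoid.IsPartition (𝒮 : Set (Set (Fin n → ℝ))) → ∀ (R : {C // C ∈ 𝒮} → KZ.IntegralRep n),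
      (∀ C, (R C).domain = r.domain ∩ C) → (∀ C, (R C).integrand = r.integrand) →
      KZ.of r - ∑ C ∈ 𝒮.attach, KZ.of (R C) ∈ KZ.relations := by
  intro n r 𝒮 hpart R hRd hRi
  -- adapted from `KZ.of_sub_sum_cyl_mem_relations` (KZGroundingRelations.lean)
  refine KZ.of_sub_sum_of_mem_relations 𝒮.attach r R (fun C _ => ?_) (fun C _ x _ => by rw [hRi])
    ?_ ?_
  · rw [hRd, Set.sdiff_eq_empty.mpr inter_subset_left, measure_empty]
  · have : r.domain \ ⋃ C ∈ 𝒮.attach, (R C).domain = ∅ := by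
      refine Set.sdiff_eq_empty.mpr fun z hz => ?_
      have hcov : z ∈ ⋃₀ (𝒮 : Set (Set (Fin n → ℝ))) := by
        rw [hpart.sUnion_eq_univ]; exact mem_univ _
      obtain ⟨C, hC, hzC⟩ := mem_sUnion.1 hcov
      refine mem_iUnion₂.2 ⟨⟨C, hC⟩, Finset.mem_attach _ _, ?_⟩
      rw [hRd]
      exact ⟨hz, hzC⟩
    rw [this, measure_empty]
  · intro C _ C' _ hne
    have hne' : (C : Set (Fin n → ℝ)) ≠ C' := fun h => hne (Subtype.ext h)
    have hdisj : Disjoint (C : Set (Fin n → ℝ)) C' := hpart.pairwiseDisjoint C.2 C'.2 hne'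
    have : (R C).domain ∩ (R C').domain = ∅ := by
      rw [hRd, hRd]
      ext z
      simp only [mem_inter_iff, mem_empty_iff_false, iff_false, not_and, and_imp]
      intro _ hzC _ hzC'
      exact hdisj.ne_of_mem hzC hzC' rfl
    rw [this, measure_empty]

end Summit.KontsevichZagierPeriods.FermatIsogeny.BetaLinearSector

end
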